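import Mathlib.Data.Nat.GCD.Basic
import Mathlib.Data.Nat.Prime.Basic
import Mathlib.RingTheory.Coprime.Lemmas
import HarnessLib

/-!
# Route `PrimeLevelFamEdge`, crux K_A `MomentsBeyondDiagonal` (stmt-Parity-20007), line «petersson_layers» v4:
# COPRIMALITY BOOKKEEPING for the regrouped layers — the two gcd facts the Pascadi bridge consumes

The bridge `…LayersPascadiBridge.norm_bilinear_dilated_le_of_pascadi` asks, on the support, for Pascadi's summation
condition `((σ₁x, σ₂y), c) = 1`; the gcd extraction `…LayersKloostermanScale` divides a term by `g = ((a, b), c)`.  Recorded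
here (elementary, `Nat` only):
* `coprime_gcd_div_gcd` — after extracting `g = ((a,b),c)` the residual triple is coprime: `((a/g, b/g), c/g) = 1`;
* `coprime_gcd_mul_mul_of_coprime` — if the flat variables `x, y` are prime to `c` and the residual dilations satisfy
  `((σ₁, σ₂), c) = 1`, then `((σ₁x, σ₂y), c) = 1` (the bridge's hypothesis);
* `dvd_at_most_one` bookkeeping: if a prime `p ∣ c` divides at most one of `m₁, n₁, m₂, n₂` then both
  `((m₁n₁, m₂n₂), c)` and `((m₁m₂, n₁n₂), c)` are prime to `p` — the «good term» criterion of the census under which the swap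
  `S(m₁n₁, m₂n₂; c) = S(m₁m₂, n₁n₂; c)` (`…LayersKloostermanProduct`) needs no extraction.
Proof only (def-free helper toward `stub_farP` / `stub_band`); nothing about any layer, K_A or Landau–Siegel zeros is claimed.
-/

namespace Summit.Parity.GeneralizedHardyLittlewood.Theorems.MomentsBeyondDiagonal.Layers

/-! ## §1. After the extraction of `g = ((a, b), c)` -/

/-- **The residual triple is coprime**: with `g = gcd (gcd a b) c` (`c ≥ 1`), `gcd (gcd (a/g) (b/g)) (c/g) = 1`. [folklore] -/
theorem coprime_gcd_div_gcd {a b c : ℕ} (hc : c ≠ 0) :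
    Nat.Coprime (Nat.gcd (a / Nat.gcd (Nat.gcd a b) c) (b / Nat.gcd (Nat.gcd a b) c)) (c / Nat.gcd (Nat.gcd a b) c) := by
  set g := Nat.gcd (Nat.gcd a b) c with hg
  have hg0 : 0 < g := Nat.pos_of_ne_zero (by rw [hg]; exact Nat.gcd_ne_zero_right hc)
  have hga : g ∣ a := (Nat.gcd_dvd_left _ _).trans (Nat.gcd_dvd_left a b)
  have hgb : g ∣ b := (Nat.gcd_dvd_left _ _).trans (Nat.gcd_dvd_right a b)
  have hgc : g ∣ c := Nat.gcd_dvd_right _ _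
  rw [Nat.Coprime, Nat.gcd_div hga hgb, Nat.gcd_div (Nat.gcd_dvd_left _ _) hgc, ← hg, Nat.div_self hg0]

/-- `g = ((a,b),c)` divides `a`, `b` and `c`, and `c = g · (c/g)` — the shape in which `…LayersKloostermanScale`
(`totient_mul_kloostermanSum_of_eq_mul`) is applied. [folklore] -/
theorem gcd_gcd_dvd_and_eq {a b c : ℕ} :
    Nat.gcd (Nat.gcd a b) c ∣ a ∧ Nat.gcd (Nat.gcd a b) c ∣ b ∧
      c = Nat.gcd (Nat.gcd a b) c * (c / Nat.gcd (Nat.gcd a b) c) :=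
  ⟨(Nat.gcd_dvd_left _ _).trans (Nat.gcd_dvd_left a b), (Nat.gcd_dvd_left _ _).trans (Nat.gcd_dvd_right a b),
    (Nat.mul_div_cancel' (Nat.gcd_dvd_right _ _)).symm⟩

/-! ## §2. Pascadi's summation condition from flat variables and coprime residual dilations -/

/-- **`((σ₁x, σ₂y), c) = 1` from `(x, c) = (y, c) = 1` and `((σ₁, σ₂), c) = 1`.** [folklore] -/
theorem coprime_gcd_mul_mul_of_coprime {σ₁ σ₂ x y c : ℕ} (hx : Nat.Coprime x c) (hy : Nat.Coprime y c)
    (hσ : Nat.Coprime (Nat.gcd σ₁ σ₂) c) : Nat.Coprime (Nat.gcd (σ₁ * x) (σ₂ * y)) c := by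
  rw [Nat.coprime_iff_gcd_eq_one] at *
  by_contra h
  obtain ⟨p, hp, hpdvd⟩ := Nat.exists_prime_and_dvd h
  have hp1 : p ∣ Nat.gcd (σ₁ * x) (σ₂ * y) := hpdvd.trans (Nat.gcd_dvd_left _ _)
  have hpc : p ∣ c := hpdvd.trans (Nat.gcd_dvd_right _ _)
  have hpx : ¬ p ∣ x := fun hpx ↦ hp.one_lt.ne' (Nat.eq_one_of_dvd_one (hx ▸ Nat.dvd_gcd hpx hpc))
  have hpy : ¬ p ∣ y := fun hpy ↦ hp.one_lt.ne' (Nat.eq_one_of_dvd_one (hy ▸ Nat.dvd_gcd hpy hpc))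
  have h1 : p ∣ σ₁ := ((Nat.Prime.dvd_mul hp).mp (hp1.trans (Nat.gcd_dvd_left _ _))).resolve_right hpx
  have h2 : p ∣ σ₂ := ((Nat.Prime.dvd_mul hp).mp (hp1.trans (Nat.gcd_dvd_right _ _))).resolve_right hpy
  exact hp.one_lt.ne' (Nat.eq_one_of_dvd_one (hσ ▸ Nat.dvd_gcd (Nat.dvd_gcd h1 h2) hpc))

/-- Flat variables alone (`σ₁ = σ₂ = 1` up to units): `(x, c) = (y, c) = 1 ⇒ ((x, y), c) = 1`. [folklore] -/
theorem coprime_gcd_of_coprime_left {x y c : ℕ} (hx : Nat.Coprime x c) : Nat.Coprime (Nat.gcd x y) c :=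
  Nat.Coprime.coprime_dvd_left (Nat.gcd_dvd_left x y) hx

/-! ## §3. The «good term» criterion -/

/-- **Good terms need no extraction**: if every prime `p ∣ c` divides at most one of `m₁, n₁, m₂, n₂` (rendered: for each
such `p`, from any two of the four divisibilities `False` follows), then `((m₁n₁, m₂n₂), c) = 1` and `((m₁m₂, n₁n₂), c) = 1`
— the two hypotheses of `kloostermanSum_mul_mul_swap_of_coprime`. [folklore] -/
theorem coprime_gcd_of_prime_dvd_at_most_one {m₁ n₁ m₂ n₂ c : ℕ}
    (h : ∀ p : ℕ, p.Prime → p ∣ c →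
      (p ∣ m₁ → p ∣ n₁ → False) ∧ (p ∣ m₁ → p ∣ m₂ → False) ∧ (p ∣ m₁ → p ∣ n₂ → False) ∧
      (p ∣ n₁ → p ∣ m₂ → False) ∧ (p ∣ n₁ → p ∣ n₂ → False) ∧ (p ∣ m₂ → p ∣ n₂ → False)) :
    Nat.Coprime (Nat.gcd (m₁ * n₁) (m₂ * n₂)) c ∧ Nat.Coprime (Nat.gcd (m₁ * m₂) (n₁ * n₂)) c := by
  constructor
  · rw [Nat.coprime_iff_gcd_eq_one]
    by_contra hne
    obtain ⟨p, hp, hpdvd⟩ := Nat.exists_prime_and_dvd hne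
    have hpc : p ∣ c := hpdvd.trans (Nat.gcd_dvd_right _ _)
    have hg : p ∣ Nat.gcd (m₁ * n₁) (m₂ * n₂) := hpdvd.trans (Nat.gcd_dvd_left _ _)
    have ha : p ∣ m₁ ∨ p ∣ n₁ := (Nat.Prime.dvd_mul hp).mp (hg.trans (Nat.gcd_dvd_left _ _))
    have hb : p ∣ m₂ ∨ p ∣ n₂ := (Nat.Prime.dvd_mul hp).mp (hg.trans (Nat.gcd_dvd_right _ _))
    obtain ⟨_, h12, h14, h32, h34, _⟩ := h p hp hpc
    rcases ha with ha | ha <;> rcases hb with hb | hb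
    · exact h12 ha hb
    · exact h14 ha hb
    · exact h32 ha hb
    · exact h34 ha hb
  · rw [Nat.coprime_iff_gcd_eq_one]
    by_contra hne
    obtain ⟨p, hp, hpdvd⟩ := Nat.exists_prime_and_dvd hne
    have hpc : p ∣ c := hpdvd.trans (Nat.gcd_dvd_right _ _)
    have hg : p ∣ Nat.gcd (m₁ * m₂) (n₁ * n₂) := hpdvd.trans (Nat.gcd_dvd_left _ _)
    have ha : p ∣ m₁ ∨ p ∣ m₂ := (Nat.Prime.dvd_mul hp).mp (hg.trans (Nat.gcd_dvd_left _ _))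
    have hb : p ∣ n₁ ∨ p ∣ n₂ := (Nat.Prime.dvd_mul hp).mp (hg.trans (Nat.gcd_dvd_right _ _))
    obtain ⟨h11, _, h14, h32, _, h24⟩ := h p hp hpc
    rcases ha with ha | ha <;> rcases hb with hb | hb
    · exact h11 ha hb
    · exact h14 ha hb
    · exact h32 hb ha
    · exact h24 ha hb

/-- The generic term: three of the four variables prime to `c` already satisfy the «at most one» criterion; cf.
`coprime_gcd_of_coprime_prod` in `…LayersKloostermanProduct`. [folklore] -/
theorem prime_dvd_at_most_one_of_coprime {m₁ n₁ m₂ c : ℕ} (n₂ : ℕ) (h₁ : Nat.Coprime m₁ c) (h₂ : Nat.Coprime n₁ c)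
    (h₃ : Nat.Coprime m₂ c) :
    ∀ p : ℕ, p.Prime → p ∣ c →
      (p ∣ m₁ → p ∣ n₁ → False) ∧ (p ∣ m₁ → p ∣ m₂ → False) ∧ (p ∣ m₁ → p ∣ n₂ → False) ∧
      (p ∣ n₁ → p ∣ m₂ → False) ∧ (p ∣ n₁ → p ∣ n₂ → False) ∧ (p ∣ m₂ → p ∣ n₂ → False) := by
  intro p hp hpc
  have k₁ : ¬ p ∣ m₁ := fun hd ↦ hp.one_lt.ne' (Nat.eq_one_of_dvd_one
    ((Nat.coprime_iff_gcd_eq_one.mp h₁) ▸ Nat.dvd_gcd hd hpc))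
  have k₂ : ¬ p ∣ n₁ := fun hd ↦ hp.one_lt.ne' (Nat.eq_one_of_dvd_one
    ((Nat.coprime_iff_gcd_eq_one.mp h₂) ▸ Nat.dvd_gcd hd hpc))
  have k₃ : ¬ p ∣ m₂ := fun hd ↦ hp.one_lt.ne' (Nat.eq_one_of_dvd_one
    ((Nat.coprime_iff_gcd_eq_one.mp h₃) ▸ Nat.dvd_gcd hd hpc))
  exact ⟨fun a _ ↦ k₁ a, fun a _ ↦ k₁ a, fun a _ ↦ k₁ a, fun a _ ↦ k₂ a, fun a _ ↦ k₂ a, fun a _ ↦ k₃ a⟩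

end Summit.Parity.GeneralizedHardyLittlewood.Theorems.MomentsBeyondDiagonal.Layers
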